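import Summits.QuantumFields.YangMills.Theses.WeakCouplingRates
import Summits.QuantumFields.YangMills.Theorems.WeakCouplingRatesColdBoxTwoPointFloorStubBoxGaussianWick

/-!
# Birth skeleton v5 (owner re-cut to the rev-2 WINDOW statement) for crux `ColdBoxTwoPointFloorW` (stmt-QuantumFields-19608) — `Lines/birth.lean`

Owner: planner `ym-beyond-p3` (g13, 2026-08-26), route `WeakCouplingRates` (route-QuantumFields-WeakCouplingRates, rev 2,
commit ec0f9e61ceaa).  v5 = the fleet lead's v4 (`pub/ym-fleet/ym-wcr-19456-p1/Lines-birth-ColdBoxTwoPointFloor.v4.lean`,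
registered 11:22Z against the now-RETIRED item stmt-QuantumFields-19456) with exactly two changes:
(1) the load-bearing stub S3c carries the window prefix `∃ θ₀ > 0, ∀ 0 < A < θ ≤ θ₀` of the new crux (θ₀ is the PROVER's);
(2) S4 spells the `ℤ⁴` kernel as `@curvaturePlaquetteCorr 4 (by norm_num) n` (no named argument, so the registrar's parser — which
cuts a signature at the first `:=` — records it whole; director-ym LINE №59 (3)).  S3a (Wick) is the tree's landed theorem (p439380),
D1 and its vocabulary are the tree's `Theorems/WeakCouplingRatesDefs.lean` (p438516).  Composition `ColdBoxTwoPointFloorW_of` BY the new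
decl name, sorries only in S3c/S4.

Crux (route file, rev 2): `ColdBoxTwoPointFloorW : ∃ θ₀ : ℝ, 0 < θ₀ ∧ ∀ A θ : ℝ, 0 < A → A < θ → θ ≤ θ₀ → ∃ c : ℝ, 0 < c ∧
BoxTwoPointDomination (G := SU(2)) (fundamentalRep (Fin 2)) A θ c` — in the cold-wall Wilson box of side `2⌈β^θ⌉+1`,
`β² · Cov(c_{p_c}, c_{p_c+⌈β^A⌉e₀}) ≥ c · C(⌈β^A⌉)²` for all large `β`, for every pair of exponents under a ceiling θ₀ of the prover's choosing.

## Stubs, sizes, and the LINE №57 «consumes:» audit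
* **S3a `stub_boxGaussianWick`** — `boxCircSqCov H T = 2·boxMaxwellPlaqCov H T²` ∀ H T.  LANDED (p439380); consumes: nothing (identity of the
  free Gaussian); size S; CLOSED.
* **S3c `stub_boxGaussianDomination`** (LOAD-BEARING, size L): `∃ θ₀ > 0, ∀ 0 < A < θ ≤ θ₀`, eventually in `β`,
  `|β²·boxPlaqCov(β,⌈β^θ⌉,⌈β^A⌉) − ¾·boxCircSqCov| ≤ ½·boxMaxwellPlaqCov²` — Gaussian domination of the CONNECTED `SU(2)` covariance at ONE
  scale: axial/comb gauge, large-field rarity in the cold box by the Gibbs–Laplace union bound (lead's landed `ymSpecification_one_real_le`,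
  p441020; window `2ε > 4θ`), second-order Laplace / Brascamp–Lieb around the flat configuration with sup-norm remainders, Dirichlet-vs-free
  Maxwell kernels at depth `T ≪ H`; the lead's power count closes it for roughly `8A + 6θ < 1/2` (naive `20θ + 8A < 1/2`), hence the ceiling.
  consumes: `0 < A` (T = ⌈β^A⌉ → ∞ makes the signal polynomially small, the count is against it), `A < θ` (pair inside the box, depth ≪ side),
  `θ ≤ θ₀` (THE window: union bound over β^{4θ} plaquettes and BCH remainders), `β₀ ≤ β` (asymptotic regime) — no idle binder.  Only the LOWER
  half of the absolute value is consumed by the composition; the upper half is the same expansion's other inequality (kept: it is what the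
  method proves and it pins the constant 3/2).
* **S4 `stub_boxKernelVsLattice`** (size M): ∀ 0 < A < θ, ∃ c₁ > 0, eventually `c₁·|C(⌈β^A⌉)| ≤ |boxMaxwellPlaqCov(⌈β^θ⌉,⌈β^A⌉)|` — free
  comb-gauge box kernel vs the `ℤ⁴` kernel at depth `T ≪ H` (Green-function comparison; numerics kit j244532: ratio ≥ 0.9885 at `T ≤ H/2`).
  consumes: `0 < A` (not needed — true at T fixed too; harmless), `A < θ` (boundary at distance ≫ separation: load-bearing), `β₀ ≤ β`.  Pure
  Gaussian, no window needed, so stated for all exponents (stronger, true, and the composition instantiates it under the ceiling).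
* `ColdBoxTwoPointFloorW_of : ColdBoxTwoPointFloorW` — θ₀ from S3c; for `A < θ ≤ θ₀`: S3c ∧ S3a give `Π² ≤ β²·Cov` (¾·2Π² − ½Π²), S4 gives
  `c₁²C² ≤ Π²`; `c = c₁²`.  Kernel-checked below.
-/

set_option autoImplicit false

noncomputable section

namespace Summit.QuantumFields.YangMills.Cruxes.ColdBoxTwoPointFloorW.Birth

open MeasureTheory
open Literature.MathematicalPhysics.QuantumFieldTheory
open Literature.MathematicalPhysics.QuantumFieldTheory.LatticeMaxwell
open Literature.MathematicalPhysics.QuantumFieldTheory.AxialGauge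
open Summit.QuantumFields.YangMills.Theorems.WeakCouplingRates
open Summit.QuantumFields.YangMills.Theses.WeakCouplingRates (ColdBoxTwoPointFloorW)

/-! ## The stubs -/

/-- **S3a — Wick/Isserlis for the squared circulations** (pure Gaussian; LANDED by the fleet lead, file
`Theorems/WeakCouplingRatesColdBoxTwoPointFloorStubBoxGaussianWick.lean`, p439380). -/
theorem stub_boxGaussianWick : ∀ H T : ℕ, boxCircSqCov H T = 2 * boxMaxwellPlaqCov H T ^ 2 :=
  Summit.QuantumFields.YangMills.Theorems.WeakCouplingRates.stub_boxGaussianWick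

/-- **S3c — Gaussian domination of the connected plaquette covariance in the cold box, under an exponent ceiling (load-bearing).**
There is `θ₀ > 0` such that for all `0 < A < θ ≤ θ₀`, eventually in `β`:
`|β² · boxPlaqCov(β, ⌈β^θ⌉, ⌈β^A⌉) − ¾ · boxCircSqCov| ≤ ½ · boxMaxwellPlaqCov²`
(`SU(2)`: three colour components, `β(2 − Re tr U_p) ≈ ½ Σ_c t^c(p)²`, hence `¾ = ¼ · 3`). -/
theorem stub_boxGaussianDomination : ∃ θ₀ : ℝ, 0 < θ₀ ∧ ∀ A θ : ℝ, 0 < A → A < θ → θ ≤ θ₀ → ∃ β₀ : ℝ, ∀ β : ℝ, β₀ ≤ β → |β ^ 2 * boxPlaqCov (Literature.MathematicalPhysics.QuantumLattice.fundamentalRep (Fin 2)) β ⌈β ^ θ⌉₊ ⌈β ^ A⌉₊ - 3 / 4 * boxCircSqCov ⌈β ^ θ⌉₊ ⌈β ^ A⌉₊| ≤ 1 / 2 * boxMaxwellPlaqCov ⌈β ^ θ⌉₊ ⌈β ^ A⌉₊ ^ 2 := by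
  sorry

/-- **S4 — box kernel vs `ℤ⁴` kernel at depth `T ≪ H`** (pure Gaussian; all exponents `0 < A < θ`; the `ℤ⁴` kernel is spelled
`@curvaturePlaquetteCorr 4 (by norm_num) n`, definitionally the route file's `curvaturePlaquetteCorr (d := 4) (by norm_num) n`). -/
theorem stub_boxKernelVsLattice : ∀ A θ : ℝ, 0 < A → A < θ → ∃ c₁ : ℝ, 0 < c₁ ∧ ∃ β₀ : ℝ, ∀ β : ℝ, β₀ ≤ β → c₁ * |@Literature.MathematicalPhysics.QuantumFieldTheory.curvaturePlaquetteCorr 4 (by norm_num) (⌈β ^ A⌉₊ : ℤ)| ≤ |boxMaxwellPlaqCov ⌈β ^ θ⌉₊ ⌈β ^ A⌉₊| := by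
  sorry

/-! ## Composition (kernel-checked): S3c ∧ S3a ∧ S4 ⇒ the crux BY NAME, `c = c₁²` -/

/-- The Gaussian floor under the ceiling (S3c ∧ S3a): `Π² = ¾·2Π² − ½Π² ≤ β²·Cov`. -/
theorem boxGaussianFloorW : ∃ θ₀ : ℝ, 0 < θ₀ ∧ ∀ A θ : ℝ, 0 < A → A < θ → θ ≤ θ₀ → ∃ β₀ : ℝ, ∀ β : ℝ, β₀ ≤ β →
    boxMaxwellPlaqCov ⌈β ^ θ⌉₊ ⌈β ^ A⌉₊ ^ 2 ≤
      β ^ 2 * boxPlaqCov (Literature.MathematicalPhysics.QuantumLattice.fundamentalRep (Fin 2)) β ⌈β ^ θ⌉₊ ⌈β ^ A⌉₊ := by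
  obtain ⟨θ₀, hθ₀, hdom⟩ := stub_boxGaussianDomination
  refine ⟨θ₀, hθ₀, fun A θ hA hAθ hθ => ?_⟩
  obtain ⟨β₀, hβ₀⟩ := hdom A θ hA hAθ hθ
  refine ⟨β₀, fun β hβ => ?_⟩
  have h := (abs_le.1 (hβ₀ β hβ)).1
  rw [stub_boxGaussianWick] at h
  linarith

/-- **Composition** — the stubs BY NAME give the crux BY NAME: θ₀ from S3c; for `0 < A < θ ≤ θ₀` and `β ≥ max β₀ β₁`,
`c₁²·C(T)² = (c₁|C(T)|)² ≤ Π² ≤ β²·boxPlaqCov`. -/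
theorem ColdBoxTwoPointFloorW_of : ColdBoxTwoPointFloorW := by
  obtain ⟨θ₀, hθ₀, hfloor⟩ := boxGaussianFloorW
  refine ⟨θ₀, hθ₀, fun A θ hA hAθ hθ => ?_⟩
  obtain ⟨β₀, h₀⟩ := hfloor A θ hA hAθ hθ
  obtain ⟨c₁, hc₁, β₁, h₁⟩ := stub_boxKernelVsLattice A θ hA hAθ
  refine ⟨c₁ ^ 2, by positivity, max β₀ β₁, fun β hβ => ?_⟩
  have h0 := h₀ β (le_trans (le_max_left _ _) hβ)
  have h1 := h₁ β (le_trans (le_max_right _ _) hβ)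
  have h1' : (c₁ * |@Literature.MathematicalPhysics.QuantumFieldTheory.curvaturePlaquetteCorr 4 (by norm_num) (⌈β ^ A⌉₊ : ℤ)|) ^ 2 ≤
      |boxMaxwellPlaqCov ⌈β ^ θ⌉₊ ⌈β ^ A⌉₊| ^ 2 :=
    pow_le_pow_left₀ (by positivity) h1 2
  rw [sq_abs] at h1'
  calc c₁ ^ 2 * Literature.MathematicalPhysics.QuantumFieldTheory.curvaturePlaquetteCorr (d := 4) (by norm_num) (⌈β ^ A⌉₊ : ℤ) ^ 2
        = (c₁ * |@Literature.MathematicalPhysics.QuantumFieldTheory.curvaturePlaquetteCorr 4 (by norm_num) (⌈β ^ A⌉₊ : ℤ)|) ^ 2 := by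
          rw [mul_pow, sq_abs]
    _ ≤ boxMaxwellPlaqCov ⌈β ^ θ⌉₊ ⌈β ^ A⌉₊ ^ 2 := h1'
    _ ≤ _ := h0

/-- Signature match: the composition has literally the route's rev-2 crux as its type. -/
example : Summit.QuantumFields.YangMills.Theses.WeakCouplingRates.ColdBoxTwoPointFloorW :=
  ColdBoxTwoPointFloorW_of

/-- Transfer (nothing proved toward the rev-0/1 statement is lost): the old ∀-form implies the window form. -/
theorem coldBoxTwoPointFloorW_of_old
    (hold : ∀ A θ : ℝ, 0 < A → A < θ → ∃ c : ℝ, 0 < c ∧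
      BoxTwoPointDomination (G := Matrix.specialUnitaryGroup (Fin 2) ℂ)
        (Literature.MathematicalPhysics.QuantumLattice.fundamentalRep (Fin 2)) A θ c) :
    ColdBoxTwoPointFloorW :=
  ⟨1, one_pos, fun A θ hA hAθ _ => hold A θ hA hAθ⟩

end Summit.QuantumFields.YangMills.Cruxes.ColdBoxTwoPointFloorW.Birth

end
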